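import Summits.QuantumFields.YangMills.Theses.BackwardLiouvilleRigidity

/-!
# Assembly of route `BackwardLiouvilleRigidity` (rung R3 of LADDER-YM; planner seat ym-r3-idea-1 g6, LINE 4 «backward-liouville-rigidity», rev 3)

The route file's kernel-checked deciding theorem `closes` packaged as the proof of the route's `Assembly` item (stmt-QuantumFields-27683):
`OneStepBackwardContraction → BackwardChainLemma → FlatRatioTermination → ClassLimitTrajectories → YM3TorusSU2`.
No summit, no Clay statement and no rung is proved here; the rung `YM3TorusSU2` (a RECORD rung) stays open behind the open cruxes
`OneStepBackwardContraction` (stmt-QuantumFields-27939) and `ClassLimitTrajectories` (stmt-QuantumFields-27940).  Width seat ym-line-sfw-p2-w2 g20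
(cell `ym-idea-1`, free hands).
-/

namespace Summit.QuantumFields.YangMills.Theorems

open MeasureTheory Filter Topology

open Summit.QuantumFields.YangMills.Theses.BackwardLiouvilleRigidity in
/-- The route's rev-12 deciding theorem, kept verbatim as a lemma: since rev 13 (KT-η repair, 2026-08-29) the route file's `closes`
is keyed to the floor-class-tails items `BackwardStabilityAdmF` / `ClassLimitTrajectoriesAdmF`, while the (closed) `Assembly` item still
reads the rev-12 binders `BackwardStabilityAdm` (via `BackwardChainLemmaAdm`) and `ClassLimitTrajectoriesAdm`; this lemma is exactly the
rev-12 proof (the old deliverer's `Summable η` feeds the old organ's `Summable η`).  No summit or rung is proved: three open hypotheses.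
[cite: Balaban1987RG1, Thm 1 p.259] -/
theorem backwardLiouvilleRigidity_closes_rev12 (hS : BackwardStabilityAdm) (hC2 : FlatRatioTermination) (hA : ClassLimitTrajectoriesAdm) :
    Literature.MathematicalPhysics.QuantumFieldTheory.Balaban1983to89.T3YM3TorusStatement.YM3TorusSU2 := by
  classical
  obtain ⟨pT, γ₂, hγ₂, h2⟩ := hC2
  obtain ⟨pm, hpm, hA⟩ := hA
  obtain ⟨γA, hγA, hA⟩ := hA (max pm pT) (le_max_left _ _)
  obtain ⟨γ₁, hγ₁, h1⟩ := hS
  refine ⟨min γA (min γ₁ γ₂), lt_min hγA (lt_min hγ₁ hγ₂), fun F γ hγ hle => ?_⟩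
  rw [Literature.MathematicalPhysics.QuantumFieldTheory.Balaban1983to89.T3ContinuumYM3Torus.continuumYM3Torus_iff_hasUniqueLimitPoints_SU
    F Literature.MathematicalPhysics.QuantumFieldTheory.Balaban1983to89.T3UnitLawDensityEML.ℰp
    Literature.MathematicalPhysics.QuantumFieldTheory.Balaban1983to89.T3UnitLawDensityEML.measurableE_ℰp hγ.le]
  intro os φ ψ hφ hψ l l' hl hl'
  have hγA' : γ ≤ γA := hle.trans (min_le_left _ _)
  have hγ1 : γ ≤ γ₁ := hle.trans ((min_le_right _ _).trans (min_le_left _ _))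
  have hγ2 : γ ≤ γ₂ := hle.trans ((min_le_right _ _).trans (min_le_right _ _))
  obtain ⟨b₀, κ, j₀, prm, ω, η, hb₀, hadm, hκ, hpos, hlim, hη, hpair⟩ := hA F γ hγ hγA'
  obtain ⟨ψ₁, ψ₁', hψ₁, hψ₁', μ, μ', ρ, ρ', hc, hc', hr, hr', hB, hIn⟩ := hpair φ ψ hφ hψ
  obtain ⟨θ, C, w₀, ε, δ, j₁, hθ, hC, hw₀, hεδ, hεs, hδs, hDs, hdec, hj₀₁, hchain⟩ :=
    h1 F γ hγ hγ1 b₀ (max pm pT) κ j₀ prm ω η hb₀ (lt_max_of_lt_left hpm) hadm hκ hpos hη μ μ' ρ ρ' hc hc' hB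
  have h2' := h2 F γ hγ hγ2 b₀ (max pm pT) κ j₀ prm ω η (le_max_right _ _) hb₀ hκ hpos hη μ μ' ρ ρ' hc hc' hB hIn
  have hG : 0 < Real.exp (∑' k, ε k + 1) := Real.exp_pos _
  have hδ0 : ∀ k, 0 ≤ δ k := fun k => (hεδ k).2
  have hDnn : ∀ i : ℕ, 0 ≤ ∑' k, δ (k + i) := fun i => tsum_nonneg fun k => hδ0 _
  have hEnn : ∀ i : ℕ, 0 ≤ ∑' n, ∑' k, δ (k + (n + i)) := fun i => tsum_nonneg fun n => hDnn _
  have hD0 : Tendsto (fun i => ∑' k, δ (k + i)) atTop (𝓝 0) := tendsto_sum_nat_add δ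
  have hE0 : Tendsto (fun i => ∑' n, ∑' k, δ (k + (n + i))) atTop (𝓝 0) :=
    tendsto_sum_nat_add fun n => ∑' k, δ (k + n)
  obtain ⟨N₁, hN₁⟩ := Metric.tendsto_atTop.mp hD0 (w₀ / 2 / Real.exp (∑' k, ε k + 1)) (by positivity)
  obtain ⟨N₂, hN₂⟩ := Metric.tendsto_atTop.mp hE0 (1 / (2 * (C + 1) * Real.exp (∑' k, ε k + 1))) (by positivity)
  have e := h2' ⟨max j₁ (max N₁ N₂), hj₀₁.trans (le_max_left _ _), fun j => Real.exp (∑' k, ε k + 1) * (1 / θ + 1) * ((∑' k, δ (k + j)) * (1 + 2 * ((F.L : ℝ) ^ j / γ) * (Fintype.card (Literature.MathematicalPhysics.QuantumFieldTheory.Balaban1983to89.Plaq (F.P j) 0) : ℝ))), fun j hj b U V hU hV hUV => by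
    have hj₁ : j₁ ≤ j := (le_max_left _ _).trans hj
    have hN₁j : N₁ ≤ j := ((le_max_left _ _).trans (le_max_right _ _)).trans hj
    have hN₂j : N₂ ≤ j := ((le_max_right _ _).trans (le_max_right _ _)).trans hj
    have hDj : ∑' k, δ (k + j) < w₀ / 2 / Real.exp (∑' k, ε k + 1) := by
      have := hN₁ j hN₁j
      rwa [Real.dist_eq, sub_zero, abs_of_nonneg (hDnn j)] at this
    have hEj : (∑' i, ∑' k, δ (k + (i + j))) < 1 / (2 * (C + 1) * Real.exp (∑' k, ε k + 1)) := by
      have := hN₂ j hN₂j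
      rwa [Real.dist_eq, sub_zero, abs_of_nonneg (hEnn j)] at this
    have hβ : 0 ≤ ((F.L : ℝ) ^ j / γ) := by positivity
    have hNp : 0 ≤ (Fintype.card (Literature.MathematicalPhysics.QuantumFieldTheory.Balaban1983to89.Plaq (F.P j) 0) : ℝ) := by positivity
    have hQ : 0 < (1 / θ + 2 * ((F.L : ℝ) ^ j / γ) * (Fintype.card (Literature.MathematicalPhysics.QuantumFieldTheory.Balaban1983to89.Plaq (F.P j) 0) : ℝ)) := by positivity
    have key : ∀ t : ℝ, 0 < t → |(Real.log (ρ j U) - Real.log (ρ' j U)) - (Real.log (ρ j V) - Real.log (ρ' j V))| ≤ Real.exp (∑' k, ε k + 1) * (1 / θ + 1) * ((∑' k, δ (k + j)) * (1 + 2 * ((F.L : ℝ) ^ j / γ) * (Fintype.card (Literature.MathematicalPhysics.QuantumFieldTheory.Balaban1983to89.Plaq (F.P j) 0) : ℝ))) + t := by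
      intro t ht
      obtain ⟨J, hJN, hJ⟩ := hlim (min (t / (Real.exp (∑' k, ε k + 1) * θ * (1 / θ + 2 * ((F.L : ℝ) ^ j / γ) * (Fintype.card (Literature.MathematicalPhysics.QuantumFieldTheory.Balaban1983to89.Plaq (F.P j) 0) : ℝ)) + 1)) (min (w₀ / (2 * Real.exp (∑' k, ε k + 1) * θ)) (1 / (2 * (C + 1) * Real.exp (∑' k, ε k + 1) * θ))))
        (by positivity) (max j 1)
      have hJj : j ≤ J := (le_max_left _ _).trans hJN
      have hJ1 : (1 : ℝ) ≤ (J : ℝ) := by exact_mod_cast (le_max_right j 1).trans hJN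
      have hωJ : 0 ≤ ω J := (hpos J).1
      have hωJ' : ω J ≤ (J : ℝ) * ω J := le_mul_of_one_le_left hωJ hJ1
      have hx : 0 ≤ (J : ℝ) * ω J := mul_nonneg (Nat.cast_nonneg _) hωJ
      have hlt1 : (J : ℝ) * ω J < t / (Real.exp (∑' k, ε k + 1) * θ * (1 / θ + 2 * ((F.L : ℝ) ^ j / γ) * (Fintype.card (Literature.MathematicalPhysics.QuantumFieldTheory.Balaban1983to89.Plaq (F.P j) 0) : ℝ)) + 1) := lt_of_lt_of_le hJ (min_le_left _ _)
      have hlt2 : (J : ℝ) * ω J < w₀ / (2 * Real.exp (∑' k, ε k + 1) * θ) := lt_of_lt_of_le hJ ((min_le_right _ _).trans (min_le_left _ _))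
      have hlt3 : (J : ℝ) * ω J < 1 / (2 * (C + 1) * Real.exp (∑' k, ε k + 1) * θ) :=
        lt_of_lt_of_le hJ ((min_le_right _ _).trans (min_le_right _ _))
      have hsmall : Real.exp (∑' k, ε k + 1) * (θ * ω J + (∑' k, δ (k + j))) ≤ w₀ := by
        have h' : ω J < w₀ / (2 * Real.exp (∑' k, ε k + 1) * θ) := lt_of_le_of_lt hωJ' hlt2
        have h1 := (lt_div_iff₀ (by positivity)).mp h'
        have h2 := (lt_div_iff₀ hG).mp hDj
        have e' : Real.exp (∑' k, ε k + 1) * (θ * ω J + (∑' k, δ (k + j))) = Real.exp (∑' k, ε k + 1) * θ * ω J + (∑' k, δ (k + j)) * Real.exp (∑' k, ε k + 1) := by ring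
        rw [e']; linarith
      have hquad : C * (Real.exp (∑' k, ε k + 1) * ((J : ℝ) * (θ * ω J) + (∑' i, ∑' k, δ (k + (i + j))))) ≤ 1 := by
        have h3 := (lt_div_iff₀ (by positivity)).mp hlt3
        have h4 := (lt_div_iff₀ (by positivity)).mp hEj
        have hy : 0 ≤ Real.exp (∑' k, ε k + 1) * ((J : ℝ) * (θ * ω J)) := mul_nonneg hG.le (mul_nonneg (Nat.cast_nonneg _) (mul_nonneg hθ.le hωJ))
        have h5 : C * (Real.exp (∑' k, ε k + 1) * ((J : ℝ) * (θ * ω J))) ≤ (C + 1) * (Real.exp (∑' k, ε k + 1) * ((J : ℝ) * (θ * ω J))) :=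
          mul_le_mul_of_nonneg_right (by linarith) hy
        have h6 : C * (Real.exp (∑' k, ε k + 1) * (∑' i, ∑' k, δ (k + (i + j)))) ≤ (C + 1) * (Real.exp (∑' k, ε k + 1) * (∑' i, ∑' k, δ (k + (i + j)))) := mul_le_mul_of_nonneg_right (by linarith) (mul_nonneg hG.le (hEnn j))
        have e' : C * (Real.exp (∑' k, ε k + 1) * ((J : ℝ) * (θ * ω J) + (∑' i, ∑' k, δ (k + (i + j))))) = C * (Real.exp (∑' k, ε k + 1) * ((J : ℝ) * (θ * ω J))) + C * (Real.exp (∑' k, ε k + 1) * (∑' i, ∑' k, δ (k + (i + j)))) := by ring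
        have e5 : (C + 1) * (Real.exp (∑' k, ε k + 1) * ((J : ℝ) * (θ * ω J))) = ((J : ℝ) * ω J * (2 * (C + 1) * Real.exp (∑' k, ε k + 1) * θ)) / 2 := by ring
        have e6 : (C + 1) * (Real.exp (∑' k, ε k + 1) * (∑' i, ∑' k, δ (k + (i + j)))) = ((∑' i, ∑' k, δ (k + (i + j))) * (2 * (C + 1) * Real.exp (∑' k, ε k + 1))) / 2 := by ring
        rw [e']; linarith
      have hb := hchain j J hj₁ hJj hsmall hquad b U V hU hV hUV
      have hω' : Real.exp (∑' k, ε k + 1) * θ * (1 / θ + 2 * ((F.L : ℝ) ^ j / γ) * (Fintype.card (Literature.MathematicalPhysics.QuantumFieldTheory.Balaban1983to89.Plaq (F.P j) 0) : ℝ)) * ω J ≤ t := by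
        have h' : ω J < t / (Real.exp (∑' k, ε k + 1) * θ * (1 / θ + 2 * ((F.L : ℝ) ^ j / γ) * (Fintype.card (Literature.MathematicalPhysics.QuantumFieldTheory.Balaban1983to89.Plaq (F.P j) 0) : ℝ)) + 1) := lt_of_le_of_lt hωJ' hlt1
        have h1 := (lt_div_iff₀ (by positivity)).mp h'
        have e' : ω J * (Real.exp (∑' k, ε k + 1) * θ * (1 / θ + 2 * ((F.L : ℝ) ^ j / γ) * (Fintype.card (Literature.MathematicalPhysics.QuantumFieldTheory.Balaban1983to89.Plaq (F.P j) 0) : ℝ)) + 1) = Real.exp (∑' k, ε k + 1) * θ * (1 / θ + 2 * ((F.L : ℝ) ^ j / γ) * (Fintype.card (Literature.MathematicalPhysics.QuantumFieldTheory.Balaban1983to89.Plaq (F.P j) 0) : ℝ)) * ω J + ω J := by ring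
        linarith
      have hD' : Real.exp (∑' k, ε k + 1) * (∑' k, δ (k + j)) * (1 / θ + 2 * ((F.L : ℝ) ^ j / γ) * (Fintype.card (Literature.MathematicalPhysics.QuantumFieldTheory.Balaban1983to89.Plaq (F.P j) 0) : ℝ)) ≤ Real.exp (∑' k, ε k + 1) * (1 / θ + 1) * ((∑' k, δ (k + j)) * (1 + 2 * ((F.L : ℝ) ^ j / γ) * (Fintype.card (Literature.MathematicalPhysics.QuantumFieldTheory.Balaban1983to89.Plaq (F.P j) 0) : ℝ))) := by
        have hθi : 0 ≤ 1 / θ := by positivity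
        have hQ' : (1 / θ + 2 * ((F.L : ℝ) ^ j / γ) * (Fintype.card (Literature.MathematicalPhysics.QuantumFieldTheory.Balaban1983to89.Plaq (F.P j) 0) : ℝ)) ≤ (1 / θ + 1) * (1 + 2 * ((F.L : ℝ) ^ j / γ) * (Fintype.card (Literature.MathematicalPhysics.QuantumFieldTheory.Balaban1983to89.Plaq (F.P j) 0) : ℝ)) := by
          nlinarith [mul_nonneg hθi (mul_nonneg (mul_nonneg zero_le_two hβ) hNp)]
        calc Real.exp (∑' k, ε k + 1) * (∑' k, δ (k + j)) * (1 / θ + 2 * ((F.L : ℝ) ^ j / γ) * (Fintype.card (Literature.MathematicalPhysics.QuantumFieldTheory.Balaban1983to89.Plaq (F.P j) 0) : ℝ)) = (Real.exp (∑' k, ε k + 1) * (∑' k, δ (k + j))) * (1 / θ + 2 * ((F.L : ℝ) ^ j / γ) * (Fintype.card (Literature.MathematicalPhysics.QuantumFieldTheory.Balaban1983to89.Plaq (F.P j) 0) : ℝ)) := by ring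
          _ ≤ (Real.exp (∑' k, ε k + 1) * (∑' k, δ (k + j))) * ((1 / θ + 1) * (1 + 2 * ((F.L : ℝ) ^ j / γ) * (Fintype.card (Literature.MathematicalPhysics.QuantumFieldTheory.Balaban1983to89.Plaq (F.P j) 0) : ℝ))) :=
              mul_le_mul_of_nonneg_left hQ' (mul_nonneg hG.le (hDnn j))
          _ = Real.exp (∑' k, ε k + 1) * (1 / θ + 1) * ((∑' k, δ (k + j)) * (1 + 2 * ((F.L : ℝ) ^ j / γ) * (Fintype.card (Literature.MathematicalPhysics.QuantumFieldTheory.Balaban1983to89.Plaq (F.P j) 0) : ℝ))) := by ring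
      calc |(Real.log (ρ j U) - Real.log (ρ' j U)) - (Real.log (ρ j V) - Real.log (ρ' j V))| ≤ Real.exp (∑' k, ε k + 1) * (θ * ω J + (∑' k, δ (k + j))) * (1 / θ + 2 * ((F.L : ℝ) ^ j / γ) * (Fintype.card (Literature.MathematicalPhysics.QuantumFieldTheory.Balaban1983to89.Plaq (F.P j) 0) : ℝ)) := hb
        _ = Real.exp (∑' k, ε k + 1) * θ * (1 / θ + 2 * ((F.L : ℝ) ^ j / γ) * (Fintype.card (Literature.MathematicalPhysics.QuantumFieldTheory.Balaban1983to89.Plaq (F.P j) 0) : ℝ)) * ω J + Real.exp (∑' k, ε k + 1) * (∑' k, δ (k + j)) * (1 / θ + 2 * ((F.L : ℝ) ^ j / γ) * (Fintype.card (Literature.MathematicalPhysics.QuantumFieldTheory.Balaban1983to89.Plaq (F.P j) 0) : ℝ)) := by ring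
        _ ≤ t + Real.exp (∑' k, ε k + 1) * (1 / θ + 1) * ((∑' k, δ (k + j)) * (1 + 2 * ((F.L : ℝ) ^ j / γ) * (Fintype.card (Literature.MathematicalPhysics.QuantumFieldTheory.Balaban1983to89.Plaq (F.P j) 0) : ℝ))) := add_le_add hω' hD'
        _ = Real.exp (∑' k, ε k + 1) * (1 / θ + 1) * ((∑' k, δ (k + j)) * (1 + 2 * ((F.L : ℝ) ^ j / γ) * (Fintype.card (Literature.MathematicalPhysics.QuantumFieldTheory.Balaban1983to89.Plaq (F.P j) 0) : ℝ))) + t := by ring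
    exact le_of_forall_pos_le_add key, by
    have h := hdec.const_mul (Real.exp (∑' k, ε k + 1) * (1 / θ + 1))
    rw [mul_zero] at h
    exact Filter.Tendsto.congr (fun j => by ring) h⟩ os
  have e1 := tendsto_nhds_unique (hl.comp hψ₁.tendsto_atTop) (hr.2 os)
  have e2 := tendsto_nhds_unique (hl'.comp hψ₁'.tendsto_atTop) (hr'.2 os)
  rw [e1, e2, e]

open Summit.QuantumFields.YangMills.Theses.BackwardLiouvilleRigidity in
/-- The `Assembly` item of route `BackwardLiouvilleRigidity` holds: it is the route's rev-12 deciding theorem read as an implication.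
[cite: Balaban1987RG1, Thm 1 p.259] -/
theorem backwardLiouvilleRigidity_assembly : Summit.QuantumFields.YangMills.Theses.BackwardLiouvilleRigidity.Assembly :=
  -- re-glued 2026-08-29 (planner ym-r3-idea-1 g15) after the rev-13 `closes` re-key to the KT-η-repaired binders
  -- (`BackwardStabilityAdmF`, `ClassLimitTrajectoriesAdmF`): the statement of `Assembly` is byte-identical; its proof now goes through the
  -- verbatim rev-12 deciding theorem `backwardLiouvilleRigidity_closes_rev12` above instead of the route file's `closes`.
  fun hC1 hL hC2 hA => backwardLiouvilleRigidity_closes_rev12 (hL hC1) hC2 hA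

end Summit.QuantumFields.YangMills.Theorems
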